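import Summits.CriticalPhenomena.SAWScalingLimit.Theorems.SAWReversalUpgradePathUpgradeRCoreA

/-!
# `PathUpgradeR`, line `bidir_windows`, the lead's stub `stub_returnsDie` — part 1b: the deterministic CORE (endgame)
(crux stmt-CriticalPhenomena-18055, route `SAWReversalUpgrade`)

Second half of the deterministic core (whole story: module docstring of `...PathUpgradeRCoreA`): the ENDGAME
(`PathUpgradeRCore.endgame`, a level drawdown is contradictory) and NO RETURN (`PathUpgradeRCore.no_return`). [folklore]
-/

noncomputable section

open Set Metric Filter Topology
open scoped unitInterval NNReal

namespace Summit.CriticalPhenomena.SAWScalingLimit.Theorems.PathUpgradeRCore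
open Literature.Probability.RandomPlanarGeometry

/-- A point of `segment p e` other than `p` is STRICTLY closer to `e` than `p` (when `p ≠ e`). [folklore] -/
theorem dist_lt_of_mem_segment_of_ne {p e z : ℂ} (hz : z ∈ segment ℝ p e) (hzp : z ≠ p) (hpe : p ≠ e) :
    dist z e < dist p e := by
  rw [segment_eq_image'] at hz
  obtain ⟨θ, hθ, rfl⟩ := hz
  have hθ0 : θ ≠ 0 := by
    rintro rfl
    simp at hzp
  have hθpos : 0 < θ := lt_of_le_of_ne hθ.1 (Ne.symm hθ0)
  have h1 : p + θ • (e - p) - e = (1 - θ) • (p - e) := by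
    simp only [smul_sub, sub_smul, one_smul]; abel
  rw [dist_eq_norm, h1, norm_smul, Real.norm_eq_abs, abs_of_nonneg (by linarith [hθ.2]), dist_eq_norm]
  have hpos : 0 < ‖p - e‖ := norm_pos_iff.2 (sub_ne_zero.2 hpe)
  nlinarith

/-! ### The endgame: a level drawdown is contradictory -/

/-- **ENDGAME.** See the module docstring. All hypotheses are conclusions of the landed stubs (`stub_flank`
forward and backward, `stub_compat`) or window / reference facts supplied by the wrapper; the drawdown is the
pair `vhi < vlo` (earlier point at forward level `β`, later point at level `α ≤ β - 9c₀`). [folklore] -/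
theorem endgame (X : Curve ℂ) (hXinj : Function.Injective X) (a b : ℂ) (Xf Xb r r' : ℝ≥0 → ℂ)
    (hr : Continuous r) (hr' : Continuous r')
    (T T' : ℝ≥0) (utop ubot : I) (Dset Fr : Set ℂ)
    (ε ε' μ μS w c₀ c₁ Ttop α₀ α₀' dS d' d'' raF rbF raP rbP : ℝ)
    (hε : 0 < ε) (hε' : 0 < ε') (hw : 0 < w) (hwc : w ≤ c₀) (hPa : raP ≤ raF) (hPb : rbP ≤ rbF)
    (hμ : ε + ε < μ) (hμS : 2 * ε + 2 * dS < μS)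
    (segF : ∀ t : ℝ≥0, (t : ℝ) ≤ T + 1 → ∃ u : I, X u = Xf t ∧ X '' Icc 0 u = Xf '' Icc 0 t)
    (segB : ∀ t : ℝ≥0, (t : ℝ) ≤ T' + 1 → ∃ u : I, X u = Xb t ∧ X '' Icc u 1 = Xb '' Icc 0 t)
    (top : X '' Icc 0 utop = Xf '' Icc 0 (T + 1)) (bot : X '' Icc ubot 1 = Xb '' Icc 0 (T' + 1))
    (injXf : InjOn Xf (Icc 0 (T + 1))) (injXb : InjOn Xb (Icc 0 (T' + 1)))
    (shF : ∀ t : ℝ≥0, (t : ℝ) ≤ T + 1 → hausdorffDist (Xf '' Icc 0 t) (r '' Icc 0 t) ≤ ε)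
    (shB : ∀ t : ℝ≥0, (t : ℝ) ≤ T' + 1 → hausdorffDist (Xb '' Icc 0 t) (r' '' Icc 0 t) ≤ ε')
    (injF : ∀ s t : ℝ≥0, (s : ℝ) ≤ T + 1 → (t : ℝ) ≤ T + 1 → w ≤ |(s : ℝ) - t| → μ ≤ dist (r s) (r t))
    (injS : ∀ s t : ℝ≥0, (s : ℝ) ≤ T + 1 → (t : ℝ) ≤ T + 1 → c₀ ≤ |(s : ℝ) - t| → μS ≤ dist (r s) (r t))
    (hF : ∀ t : ℝ≥0, (t : ℝ) ≤ T → ∀ ut : ℝ≥0, α₀ ≤ (ut : ℝ) → (ut : ℝ) ≤ T + 1 →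
      dist (Xf t) (r ut) ≤ 2 * ε →
      (∃ s : ℝ≥0, s ≤ t ∧ ∃ us : ℝ≥0, (us : ℝ) ≤ T + 1 ∧ dist (Xf s) (r us) ≤ 2 * ε ∧ (ut : ℝ) + c₀ ≤ us) →
      ∀ e ∈ Dset, dist e (Xf t) ≤ 2 * dS → d' ≤ infDist e (r '' Icc 0 (T + 1) ∪ Fr) →
      ∃ s : ℝ≥0, s < t ∧ Xf s ∈ segment ℝ (Xf t) e)
    (hB : ∀ t : ℝ≥0, (t : ℝ) ≤ T' → ∀ ut : ℝ≥0, α₀' ≤ (ut : ℝ) → (ut : ℝ) ≤ T' + 1 →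
      dist (Xb t) (r' ut) ≤ 2 * ε' →
      (∃ s : ℝ≥0, s ≤ t ∧ ∃ us : ℝ≥0, (us : ℝ) ≤ T' + 1 ∧ dist (Xb s) (r' us) ≤ 2 * ε' ∧ (ut : ℝ) + c₁ ≤ us) →
      ∀ e ∈ Dset, dist e (Xb t) ≤ 2 * dS → d'' ≤ infDist e (r' '' Icc 0 (T' + 1) ∪ Fr) →
      ∃ s : ℝ≥0, s < t ∧ Xb s ∈ segment ℝ (Xb t) e)
    (hC : ∀ v₁ v₂ : I, ∀ u₁ u₂ u₃ : ℝ≥0, (u₂ : ℝ) + 2 * w ≤ u₃ → (u₃ : ℝ) ≤ Ttop →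
      rbF - ε ≤ dist (r u₃) b → dist (X v₁) (r u₁) ≤ 2 * ε →
      dist (X v₂) (r u₂) ≤ 2 * ε → (u₁ : ℝ) + 2 * c₀ ≤ u₂ → ∀ u₁' u₂' : ℝ≥0, (u₁' : ℝ) ≤ T' + 1 →
      (u₂' : ℝ) ≤ T' + 1 → dist (X v₁) (r' u₁') ≤ 2 * ε' → dist (X v₂) (r' u₂') ≤ 2 * ε' →
      (u₂' : ℝ) + c₁ ≤ u₁')
    (por : ∀ (y : ℂ) (u : ℝ≥0), α₀ ≤ (u : ℝ) → (u : ℝ) ≤ Ttop + w → dist y (r u) ≤ ε →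
      (∃ u₃ : ℝ≥0, u ≤ u₃ ∧ (u₃ : ℝ) ≤ T + 1 ∧ rbF - ε ≤ dist (r u₃) b) →
      ∃ e ∈ Dset, dist e y ≤ 2 * dS ∧ d' ≤ infDist e (r '' Icc 0 (T + 1) ∪ Fr) ∧
        d'' ≤ infDist e (r' '' Icc 0 (T' + 1) ∪ Fr))
    (Wf : ∀ v : I, utop < v → dist (X v) b < rbP) (Wb : ∀ v : I, v < ubot → dist (X v) a < raP)
    (Zb : ∀ u : ℝ≥0, (u : ℝ) ≤ T + 1 → Ttop < (u : ℝ) → dist (r u) b < rbF - ε)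
    (Zb' : ∀ u u' : ℝ≥0, u ≤ u' → (u' : ℝ) ≤ T + 1 → rbF - ε ≤ dist (r u') b →
      rbP + ε + 2 * dS ≤ dist (r u) b)
    (Za : ∀ u : ℝ≥0, (u : ℝ) ≤ T + 1 → (u : ℝ) < α₀ → dist (r u) a < raP - ε)
    (Za' : ∀ u' u : ℝ≥0, u' ≤ u → (u : ℝ) ≤ T + 1 → raF - ε ≤ dist (r u') a →
      raP + ε + 2 * dS ≤ dist (r u) a)
    (Zab' : ∀ u' : ℝ≥0, (u' : ℝ) ≤ T' + 1 → (u' : ℝ) < α₀' → dist (r' u') b < rbP - ε')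
    (capF : ∀ v : I, rbP ≤ dist (X v) b → X v ∈ Xf '' Icc 0 T)
    (capB : ∀ v : I, raP ≤ dist (X v) a → X v ∈ Xb '' Icc 0 T')
    -- the drawdown
    (vhi vlo : I) (hlt : vhi < vlo) (β α : ℝ≥0) (hβT : (β : ℝ) ≤ T + 1) (hαT : (α : ℝ) ≤ T + 1)
    (hβ : dist (X vhi) (r β) ≤ ε) (hα : dist (X vlo) (r α) ≤ ε) (hgap : (α : ℝ) + 9 * c₀ ≤ β)
    (hhib : rbF ≤ dist (X vhi) b)
    (hloa : raF ≤ dist (X vlo) a) (hlob : rbF ≤ dist (X vlo) b) : False := by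
  /- (0) preliminaries: honest Hausdorff shadowing, window memberships -/
  have hrc : ∀ t : ℝ≥0, IsCompact (r '' Icc 0 t) := fun t => isCompact_Icc.image hr
  have hr'c : ∀ t : ℝ≥0, IsCompact (r' '' Icc 0 t) := fun t => isCompact_Icc.image hr'
  have hXfc : ∀ t : ℝ≥0, (t : ℝ) ≤ T + 1 → IsCompact (Xf '' Icc 0 t) := by
    intro t ht
    obtain ⟨u, -, hu⟩ := segF t ht
    rw [← hu]
    exact isCompact_Icc.image X.continuous
  have hXbc : ∀ t : ℝ≥0, (t : ℝ) ≤ T' + 1 → IsCompact (Xb '' Icc 0 t) := by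
    intro t ht
    obtain ⟨u, -, hu⟩ := segB t ht
    rw [← hu]
    exact isCompact_Icc.image X.continuous
  have witF : ∀ t : ℝ≥0, (t : ℝ) ≤ T + 1 → ∀ y ∈ Xf '' Icc 0 t, ∃ u : ℝ≥0, u ≤ t ∧ dist y (r u) ≤ ε := by
    intro t ht y hy
    obtain ⟨z, ⟨u, hu, rfl⟩, hz⟩ := exists_mem_dist_le_of_hausdorffDist_le (hXfc t ht) (hrc t)
      ⟨r 0, 0, ⟨le_rfl, bot_le⟩, rfl⟩ (shF t ht) hy
    exact ⟨u, hu.2, hz⟩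
  have witB : ∀ t : ℝ≥0, (t : ℝ) ≤ T' + 1 → ∀ y ∈ Xb '' Icc 0 t, ∃ u : ℝ≥0, u ≤ t ∧ dist y (r' u) ≤ ε' := by
    intro t ht y hy
    obtain ⟨z, ⟨u, hu, rfl⟩, hz⟩ := exists_mem_dist_le_of_hausdorffDist_le (hXbc t ht) (hr'c t)
      ⟨r' 0, 0, ⟨le_rfl, bot_le⟩, rfl⟩ (shB t ht) hy
    exact ⟨u, hu.2, hz⟩
  have le_utop : ∀ v : I, rbF ≤ dist (X v) b → v ≤ utop :=
    fun v hv => le_of_not_gt fun h => (not_lt.2 (hPb.trans hv)) (Wf v h)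
  have ge_ubot : ∀ v : I, raF ≤ dist (X v) a → ubot ≤ v :=
    fun v hv => le_of_not_gt fun h => (not_lt.2 (hPa.trans hv)) (Wb v h)
  have memTop : ∀ v : I, v ≤ utop → X v ∈ Xf '' Icc 0 (T + 1) := by
    intro v hv
    rw [← top]
    exact ⟨v, ⟨v.2.1, hv⟩, rfl⟩
  have memBot : ∀ v : I, ubot ≤ v → X v ∈ Xb '' Icc 0 (T' + 1) := by
    intro v hv
    rw [← bot]
    exact ⟨v, ⟨hv, v.2.2⟩, rfl⟩
  have hT1 : ((T + 1 : ℝ≥0) : ℝ) ≤ T + 1 := by push_cast; exact le_rfl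
  have hT1' : ((T' + 1 : ℝ≥0) : ℝ) ≤ T' + 1 := by push_cast; exact le_rfl
  /- (1) levels of the two drawdown points -/
  have hvlo_top : vlo ≤ utop := le_utop vlo hlob
  have hβTtop : (β : ℝ) ≤ Ttop := by
    by_contra h
    push Not at h
    have h1 := Zb β hβT h
    have h2 : dist (X vhi) b ≤ dist (X vhi) (r β) + dist (r β) b := dist_triangle _ _ _
    linarith
  have hαα₀ : α₀ ≤ (α : ℝ) := by
    by_contra h
    push Not at h
    have h1 := Za α hαT h
    have h2 : dist (X vlo) a ≤ dist (X vlo) (r α) + dist (r α) a := dist_triangle _ _ _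
    linarith
  have hc₀ : 0 < c₀ := hw.trans_le hwc
  /- (2) the mid-level point `x₀ = X vm` with witness `um ∈ [xs, xs + w)` -/
  set xs : ℝ := ((α : ℝ) + β) / 2 with hxs
  have hwit : ∀ v ∈ Icc vhi vlo, ∃ u : ℝ≥0, (u : ℝ) ≤ T + 1 ∧ dist (X v) (r u) ≤ ε := by
    intro v hv
    obtain ⟨u, hu, hd⟩ := witF (T + 1) hT1 (X v) (memTop v (hv.2.trans hvlo_top))
    exact ⟨u, by exact_mod_cast hu, hd⟩
  have hx1 : xs ≤ (β : ℝ) := by rw [hxs]; linarith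
  have hx2 : (α : ℝ) + w ≤ xs := by rw [hxs]; linarith
  obtain ⟨vm, hvm, um, humT, hum, hxum, humx⟩ := exists_witness_near_level X hr injF hμ hlt.le hwit
    hβT hβ hx1 hαT hα hx2
  set x₀ : ℂ := X vm with hx₀
  have humTtop : (um : ℝ) ≤ Ttop + w := by linarith
  have humα₀ : α₀ ≤ (um : ℝ) := by linarith
  have humβ : um ≤ β := by
    have : (um : ℝ) ≤ β := by linarith
    exact_mod_cast this
  have hrβ : rbF - ε ≤ dist (r β) b := by
    have h2 : dist (X vhi) b ≤ dist (X vhi) (r β) + dist (r β) b := dist_triangle _ _ _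
    linarith
  /- (3) the far point `e` and (4) the extremal point `p` of `X ∩ segment x₀ e` -/
  obtain ⟨e, heD, hex₀, he', he''⟩ := por x₀ um humα₀ humTtop hum ⟨β, humβ, hβT, hrβ⟩
  set Kset : Set I := {v | X v ∈ segment ℝ x₀ e} with hKset
  have hsegc : IsCompact (segment ℝ x₀ e) := by
    rw [segment_eq_image']
    exact isCompact_Icc.image (by fun_prop)
  have hKc : IsCompact Kset :=
    (IsClosed.preimage X.continuous hsegc.isClosed).isCompact
  have hKne : Kset.Nonempty := ⟨vm, left_mem_segment ℝ x₀ e⟩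
  obtain ⟨v₀, hv₀K, hv₀min⟩ :=
    hKc.exists_isMinOn hKne (X.continuous.dist continuous_const).continuousOn
  set p : ℂ := X v₀ with hp
  have hpseg : p ∈ segment ℝ x₀ e := hv₀K
  have hex₀' : dist x₀ e ≤ 2 * dS := by rwa [dist_comm] at hex₀
  have hpx₀ : dist p x₀ ≤ 2 * dS := by
    have hpseg' : p ∈ segment ℝ e x₀ := by rw [segment_symm]; exact hpseg
    have h := Literature.Topology.PlaneTopology.dist_le_of_mem_segment_center hpseg'
    rw [dist_comm e x₀] at h
    exact h.trans hex₀'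
  have hpe : dist e p ≤ 2 * dS := by
    rw [dist_comm]
    exact (Literature.Topology.PlaneTopology.dist_le_of_mem_segment_center hpseg).trans hex₀'
  have hmin : ∀ v ∈ Kset, dist p e ≤ dist (X v) e := fun v hv => isMinOn_iff.1 hv₀min v hv
  /- (5) `p` is far from `a` and `b` (reference no-escape / no-deep-return between the drawdown levels) -/
  have hαum : α ≤ um := by
    have : (α : ℝ) ≤ um := by linarith
    exact_mod_cast this
  have hrα : raF - ε ≤ dist (r α) a := by
    have h2 : dist (X vlo) a ≤ dist (X vlo) (r α) + dist (r α) a := dist_triangle _ _ _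
    linarith
  have hpb : rbP ≤ dist p b := by
    have h1 := Zb' um β humβ hβT hrβ
    have h2 : dist (r um) b ≤ dist (r um) x₀ + dist x₀ p + dist p b := dist_triangle4 _ _ _ _
    rw [dist_comm (r um) x₀, dist_comm x₀ p] at h2
    linarith
  have hpa : raP ≤ dist p a := by
    have h1 := Za' α um hαum humT hrα
    have h2 : dist (r um) a ≤ dist (r um) x₀ + dist x₀ p + dist p a := dist_triangle4 _ _ _ _
    rw [dist_comm (r um) x₀, dist_comm x₀ p] at h2
    linarith
  /- (6) `p` in the forward window: `p = Xf tp`, `tp ≤ T`, witness `up` with `|up - um| < c₀` -/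
  obtain ⟨tp, htp, hptp⟩ := capF v₀ hpb
  have htpT1 : (tp : ℝ) ≤ T + 1 := by
    have := htp.2
    have : (tp : ℝ) ≤ T := by exact_mod_cast this
    linarith
  have htp1 : tp ≤ T + 1 := htp.2.trans le_self_add
  obtain ⟨up, hup_le, hup⟩ := witF tp htpT1 p ⟨tp, ⟨bot_le, le_rfl⟩, hptp⟩
  have hupT : (up : ℝ) ≤ T + 1 := (NNReal.coe_le_coe.2 hup_le).trans htpT1
  have hupum : |(up : ℝ) - um| < c₀ :=
    abs_sub_lt_of_witness injS hupT humT hup hum hpx₀ (by linarith)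
  have hupα₀ : α₀ ≤ (up : ℝ) := by
    by_contra h
    push Not at h
    have h1 := Za up hupT h
    have h2 : dist p a ≤ dist p (r up) + dist (r up) a := dist_triangle _ _ _
    linarith
  obtain ⟨uu, huu, hsegp⟩ := segF tp htpT1
  have huuv₀ : uu = v₀ := hXinj (by rw [huu, hptp])
  rw [huuv₀] at hsegp
  rw [abs_lt] at hupum
  /- (7) `p` in the backward window: `p = Xb tq`, `tq ≤ T'`, witness `uq ≥ α₀'` -/
  obtain ⟨tq, htq, hptq⟩ := capB v₀ hpa
  have htqT1 : (tq : ℝ) ≤ T' + 1 := by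
    have := htq.2
    have : (tq : ℝ) ≤ T' := by exact_mod_cast this
    linarith
  have htq1 : tq ≤ T' + 1 := htq.2.trans le_self_add
  obtain ⟨uq, huq_le, huq⟩ := witB tq htqT1 p ⟨tq, ⟨bot_le, le_rfl⟩, hptq⟩
  have huqT : (uq : ℝ) ≤ T' + 1 := (NNReal.coe_le_coe.2 huq_le).trans htqT1
  have huqα₀' : α₀' ≤ (uq : ℝ) := by
    by_contra h
    push Not at h
    have h1 := Zab' uq huqT h
    have h2 : dist p b ≤ dist p (r' uq) + dist (r' uq) b := dist_triangle _ _ _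
    linarith
  obtain ⟨ub, hub, hsegq⟩ := segB tq htqT1
  have hubv₀ : ub = v₀ := hXinj (by rw [hub, hptq])
  rw [hubv₀] at hsegq
  /- the common contradiction: a point of `X ∩ segment p e` other than `p` is impossible -/
  have key : ∀ v' : I, v' ≠ v₀ → X v' ∈ segment ℝ p e → False := by
    intro v' hne hmem
    have hv'K : v' ∈ Kset := segment_subset_segment_of_mem hpseg hmem
    have h1 := hmin v' hv'K
    by_cases hpe0 : p = e
    · rw [hpe0, segment_same] at hmem
      exact hne (hXinj (by rw [mem_singleton_iff.1 hmem, ← hpe0]))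
    · exact absurd h1 (not_le.2 (dist_lt_of_mem_segment_of_ne hmem (fun h => hne (hXinj h)) hpe0))
  /- (8) case split on the position of `p` relative to the high point -/
  rcases le_or_gt vhi v₀ with hcase | hcase
  · -- Case A: `vhi ≤ v₀`: `p` is forward-sub-front (witness `β` at the earlier point `X vhi`)
    have hmem : X vhi ∈ Xf '' Icc 0 tp := by
      rw [← hsegp]
      exact ⟨vhi, ⟨vhi.2.1, hcase⟩, rfl⟩
    obtain ⟨shi, hshi, hXshi⟩ := hmem
    have hsub : ∃ s : ℝ≥0, s ≤ tp ∧ ∃ us : ℝ≥0, (us : ℝ) ≤ T + 1 ∧ dist (Xf s) (r us) ≤ 2 * ε ∧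
        (up : ℝ) + c₀ ≤ us :=
      ⟨shi, hshi.2, β, hβT, by rw [hXshi]; linarith, by linarith⟩
    obtain ⟨s, hs, hXs⟩ := hF tp (by exact_mod_cast htp.2) up hupα₀ hupT (by rw [hptp]; linarith)
      hsub e heD (by rw [hptp]; exact hpe) he'
    rw [hptp] at hXs
    have hmem2 : Xf s ∈ X '' Icc 0 v₀ := by
      rw [hsegp]
      exact ⟨s, ⟨bot_le, hs.le⟩, rfl⟩
    obtain ⟨v', hv', hXv'⟩ := hmem2
    refine key v' ?_ (by rw [hXv']; exact hXs)
    intro h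
    rw [h] at hXv'
    have : s = tp := injXf ⟨bot_le, hs.le.trans htp1⟩ ⟨bot_le, htp1⟩ (by rw [← hXv', ← hp, hptp])
    exact absurd this hs.ne
  · -- Case B: `v₀ < vhi < vlo`: `p` is backward-sub-front via the later low point `X vlo` and `Compat`
    have hvlo_bot : ubot ≤ vlo := ge_ubot vlo hloa
    obtain ⟨ulo', hulo'_le, hulo'⟩ := witB (T' + 1) hT1' (X vlo) (memBot vlo hvlo_bot)
    have hulo'T : (ulo' : ℝ) ≤ T' + 1 := by exact_mod_cast hulo'_le
    have hcomp : (uq : ℝ) + c₁ ≤ ulo' :=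
      hC vlo v₀ α up β (by linarith) hβTtop hrβ (by linarith) (by rw [← hp]; linarith) (by linarith) ulo' uq
        hulo'T huqT (by linarith) (by rw [← hp]; linarith)
    have hmem : X vlo ∈ Xb '' Icc 0 tq := by
      rw [← hsegq]
      exact ⟨vlo, ⟨(hcase.trans hlt).le, vlo.2.2⟩, rfl⟩
    obtain ⟨slo, hslo, hXslo⟩ := hmem
    have hsub : ∃ s : ℝ≥0, s ≤ tq ∧ ∃ us : ℝ≥0, (us : ℝ) ≤ T' + 1 ∧ dist (Xb s) (r' us) ≤ 2 * ε' ∧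
        (uq : ℝ) + c₁ ≤ us :=
      ⟨slo, hslo.2, ulo', hulo'T, by rw [hXslo]; linarith, hcomp⟩
    obtain ⟨s, hs, hXs⟩ := hB tq (by exact_mod_cast htq.2) uq huqα₀' huqT (by rw [hptq]; linarith)
      hsub e heD (by rw [hptq]; exact hpe) he''
    rw [hptq] at hXs
    have hmem2 : Xb s ∈ X '' Icc v₀ 1 := by
      rw [hsegq]
      exact ⟨s, ⟨bot_le, hs.le⟩, rfl⟩
    obtain ⟨v', hv', hXv'⟩ := hmem2
    refine key v' ?_ (by rw [hXv']; exact hXs)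
    intro h
    rw [h] at hXv'
    have : s = tq := injXb ⟨bot_le, hs.le.trans htq1⟩ ⟨bot_le, htq1⟩ (by rw [← hXv', ← hp, hptq])
    exact absurd this hs.ne

/-! ### Returns force drawdowns -/

/-- **NO RETURN.** Under the hypotheses of `endgame` (all but the drawdown), the coarse continuity of the forward
reference at scale `9c₀ + w` below `ℓ - 2ε` (`mc`), and `3ε < μ`, an `(ℓ, ε)`-return `s₀ < u₀ < t₀` whose three
points are far from `a` and `b` is impossible: the forward levels of `X s₀` and `X t₀` agree up to `w`, that of
`X u₀` differs by `≥ 9c₀ + w`, which is a drawdown one way or the other. [folklore] -/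
theorem no_return (X : Curve ℂ) (hXinj : Function.Injective X) (a b : ℂ) (Xf Xb r r' : ℝ≥0 → ℂ)
    (hr : Continuous r) (hr' : Continuous r')
    (T T' : ℝ≥0) (utop ubot : I) (Dset Fr : Set ℂ)
    (ε ε' μ μS w c₀ c₁ Ttop α₀ α₀' dS d' d'' raF rbF raP rbP ℓ : ℝ)
    (hε : 0 < ε) (hε' : 0 < ε') (hw : 0 < w) (hwc : w ≤ c₀) (hPa : raP ≤ raF) (hPb : rbP ≤ rbF)
    (hμ : ε + ε + ε < μ) (hμS : 2 * ε + 2 * dS < μS)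
    (segF : ∀ t : ℝ≥0, (t : ℝ) ≤ T + 1 → ∃ u : I, X u = Xf t ∧ X '' Icc 0 u = Xf '' Icc 0 t)
    (segB : ∀ t : ℝ≥0, (t : ℝ) ≤ T' + 1 → ∃ u : I, X u = Xb t ∧ X '' Icc u 1 = Xb '' Icc 0 t)
    (top : X '' Icc 0 utop = Xf '' Icc 0 (T + 1)) (bot : X '' Icc ubot 1 = Xb '' Icc 0 (T' + 1))
    (injXf : InjOn Xf (Icc 0 (T + 1))) (injXb : InjOn Xb (Icc 0 (T' + 1)))
    (shF : ∀ t : ℝ≥0, (t : ℝ) ≤ T + 1 → hausdorffDist (Xf '' Icc 0 t) (r '' Icc 0 t) ≤ ε)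
    (shB : ∀ t : ℝ≥0, (t : ℝ) ≤ T' + 1 → hausdorffDist (Xb '' Icc 0 t) (r' '' Icc 0 t) ≤ ε')
    (injF : ∀ s t : ℝ≥0, (s : ℝ) ≤ T + 1 → (t : ℝ) ≤ T + 1 → w ≤ |(s : ℝ) - t| → μ ≤ dist (r s) (r t))
    (injS : ∀ s t : ℝ≥0, (s : ℝ) ≤ T + 1 → (t : ℝ) ≤ T + 1 → c₀ ≤ |(s : ℝ) - t| → μS ≤ dist (r s) (r t))
    (mc : ∀ s t : ℝ≥0, (s : ℝ) ≤ T + 1 → (t : ℝ) ≤ T + 1 → |(s : ℝ) - t| < 9 * c₀ + w →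
      dist (r s) (r t) < ℓ - 2 * ε)
    (hF : ∀ t : ℝ≥0, (t : ℝ) ≤ T → ∀ ut : ℝ≥0, α₀ ≤ (ut : ℝ) → (ut : ℝ) ≤ T + 1 →
      dist (Xf t) (r ut) ≤ 2 * ε →
      (∃ s : ℝ≥0, s ≤ t ∧ ∃ us : ℝ≥0, (us : ℝ) ≤ T + 1 ∧ dist (Xf s) (r us) ≤ 2 * ε ∧ (ut : ℝ) + c₀ ≤ us) →
      ∀ e ∈ Dset, dist e (Xf t) ≤ 2 * dS → d' ≤ infDist e (r '' Icc 0 (T + 1) ∪ Fr) →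
      ∃ s : ℝ≥0, s < t ∧ Xf s ∈ segment ℝ (Xf t) e)
    (hB : ∀ t : ℝ≥0, (t : ℝ) ≤ T' → ∀ ut : ℝ≥0, α₀' ≤ (ut : ℝ) → (ut : ℝ) ≤ T' + 1 →
      dist (Xb t) (r' ut) ≤ 2 * ε' →
      (∃ s : ℝ≥0, s ≤ t ∧ ∃ us : ℝ≥0, (us : ℝ) ≤ T' + 1 ∧ dist (Xb s) (r' us) ≤ 2 * ε' ∧ (ut : ℝ) + c₁ ≤ us) →
      ∀ e ∈ Dset, dist e (Xb t) ≤ 2 * dS → d'' ≤ infDist e (r' '' Icc 0 (T' + 1) ∪ Fr) →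
      ∃ s : ℝ≥0, s < t ∧ Xb s ∈ segment ℝ (Xb t) e)
    (hC : ∀ v₁ v₂ : I, ∀ u₁ u₂ u₃ : ℝ≥0, (u₂ : ℝ) + 2 * w ≤ u₃ → (u₃ : ℝ) ≤ Ttop →
      rbF - ε ≤ dist (r u₃) b → dist (X v₁) (r u₁) ≤ 2 * ε →
      dist (X v₂) (r u₂) ≤ 2 * ε → (u₁ : ℝ) + 2 * c₀ ≤ u₂ → ∀ u₁' u₂' : ℝ≥0, (u₁' : ℝ) ≤ T' + 1 →
      (u₂' : ℝ) ≤ T' + 1 → dist (X v₁) (r' u₁') ≤ 2 * ε' → dist (X v₂) (r' u₂') ≤ 2 * ε' →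
      (u₂' : ℝ) + c₁ ≤ u₁')
    (por : ∀ (y : ℂ) (u : ℝ≥0), α₀ ≤ (u : ℝ) → (u : ℝ) ≤ Ttop + w → dist y (r u) ≤ ε →
      (∃ u₃ : ℝ≥0, u ≤ u₃ ∧ (u₃ : ℝ) ≤ T + 1 ∧ rbF - ε ≤ dist (r u₃) b) →
      ∃ e ∈ Dset, dist e y ≤ 2 * dS ∧ d' ≤ infDist e (r '' Icc 0 (T + 1) ∪ Fr) ∧
        d'' ≤ infDist e (r' '' Icc 0 (T' + 1) ∪ Fr))
    (Wf : ∀ v : I, utop < v → dist (X v) b < rbP) (Wb : ∀ v : I, v < ubot → dist (X v) a < raP)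
    (Zb : ∀ u : ℝ≥0, (u : ℝ) ≤ T + 1 → Ttop < (u : ℝ) → dist (r u) b < rbF - ε)
    (Zb' : ∀ u u' : ℝ≥0, u ≤ u' → (u' : ℝ) ≤ T + 1 → rbF - ε ≤ dist (r u') b →
      rbP + ε + 2 * dS ≤ dist (r u) b)
    (Za : ∀ u : ℝ≥0, (u : ℝ) ≤ T + 1 → (u : ℝ) < α₀ → dist (r u) a < raP - ε)
    (Za' : ∀ u' u : ℝ≥0, u' ≤ u → (u : ℝ) ≤ T + 1 → raF - ε ≤ dist (r u') a →
      raP + ε + 2 * dS ≤ dist (r u) a)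
    (Zab' : ∀ u' : ℝ≥0, (u' : ℝ) ≤ T' + 1 → (u' : ℝ) < α₀' → dist (r' u') b < rbP - ε')
    (capF : ∀ v : I, rbP ≤ dist (X v) b → X v ∈ Xf '' Icc 0 T)
    (capB : ∀ v : I, raP ≤ dist (X v) a → X v ∈ Xb '' Icc 0 T')
    -- the return
    (s₀ u₀ t₀ : I) (hsu : s₀ < u₀) (hut : u₀ < t₀) (hfar : ℓ ≤ dist (X s₀) (X u₀))
    (hret : dist (X s₀) (X t₀) ≤ ε)
    (hsb : rbF ≤ dist (X s₀) b) (hua : raF ≤ dist (X u₀) a)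
    (hub : rbF ≤ dist (X u₀) b) (hta : raF ≤ dist (X t₀) a) (htb : rbF ≤ dist (X t₀) b) : False := by
  have hend := endgame X hXinj a b Xf Xb r r' hr hr' T T' utop ubot Dset Fr ε ε' μ μS w c₀ c₁ Ttop α₀ α₀'
    dS d' d'' raF rbF raP rbP hε hε' hw hwc hPa hPb (by linarith) hμS segF segB top bot injXf injXb shF shB
    injF injS hF hB hC por Wf Wb Zb Zb' Za Za' Zab' capF capB
  -- witnesses of the three points
  have hrc : IsCompact (r '' Icc 0 (T + 1)) := isCompact_Icc.image hr
  have hXfc : IsCompact (Xf '' Icc 0 (T + 1)) := by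
    rw [← top]
    exact isCompact_Icc.image X.continuous
  have hT1 : ((T + 1 : ℝ≥0) : ℝ) ≤ T + 1 := by push_cast; exact le_rfl
  have wit : ∀ v : I, rbF ≤ dist (X v) b → ∃ u : ℝ≥0, (u : ℝ) ≤ T + 1 ∧ dist (X v) (r u) ≤ ε := by
    intro v hv
    have hvtop : v ≤ utop := le_of_not_gt fun h => (not_lt.2 (hPb.trans hv)) (Wf v h)
    have hmem : X v ∈ Xf '' Icc 0 (T + 1) := by
      rw [← top]
      exact ⟨v, ⟨v.2.1, hvtop⟩, rfl⟩
    obtain ⟨z, ⟨u, hu, rfl⟩, hz⟩ := exists_mem_dist_le_of_hausdorffDist_le hXfc hrc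
      ⟨r 0, 0, ⟨le_rfl, bot_le⟩, rfl⟩ (shF (T + 1) hT1) hmem
    exact ⟨u, by exact_mod_cast hu.2, hz⟩
  obtain ⟨us, husT, hus⟩ := wit s₀ hsb
  obtain ⟨uu, huuT, huu⟩ := wit u₀ hub
  obtain ⟨ut, hutT, hut'⟩ := wit t₀ htb
  -- `|us - ut| < w`
  have hst : |(us : ℝ) - ut| < w := abs_sub_lt_of_witness injF husT hutT hus hut' hret (by linarith)
  -- `|us - uu| ≥ 9 c₀ + w`
  have hsu' : 9 * c₀ + w ≤ |(us : ℝ) - uu| := by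
    by_contra h
    push Not at h
    have h1 := mc us uu husT huuT h
    have h2 : dist (X s₀) (X u₀) ≤ dist (X s₀) (r us) + dist (r us) (r uu) + dist (r uu) (X u₀) :=
      dist_triangle4 _ _ _ _
    rw [dist_comm (r uu) (X u₀)] at h2
    linarith
  rw [abs_lt] at hst
  rcases le_abs.1 hsu' with h | h
  · -- `uu ≤ us - 9c₀ - w`: high point `X s₀`, low point `X u₀`
    exact hend s₀ u₀ hsu us uu husT huuT hus huu (by linarith) hsb hua hub
  · -- `uu ≥ us + 9c₀ + w`: high point `X u₀`, low point `X t₀`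
    exact hend u₀ t₀ hut uu ut huuT hutT huu hut' (by linarith) hub hta htb

end Summit.CriticalPhenomena.SAWScalingLimit.Theorems.PathUpgradeRCore

namespace Summit.CriticalPhenomena.SAWScalingLimit.Theorems
/-- Registered auxiliary stub `stub_returnsDie_coreB` of crux stmt-CriticalPhenomena-18055 (strict segment distance). -/
theorem stub_returnsDie_coreB : ∀ p e z : ℂ, z ∈ segment ℝ p e → z ≠ p → p ≠ e → dist z e < dist p e :=
  fun _ _ _ hz hzp hpe => PathUpgradeRCore.dist_lt_of_mem_segment_of_ne hz hzp hpe

end Summit.CriticalPhenomena.SAWScalingLimit.Theorems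

end
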